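import Mathlib
import HarnessLib
import HarnessLib.Audit
import Summits.AnomalousDissipation.Statement
import Literature.Analysis.FluidPDE.NSGalerkinFourier
import Literature.Analysis.FluidPDE.TurbWave0
import HarnessLib.Audit.Status.Attr

/-!
Route: DecimationAxis

DORMANT since 2026-08-25T08:51:21Z (reconciler: no traction for 7.6 d (last activity item-evidence-added at 2026-08-17T19:06:55Z); parked, not closed — `ledger route dormant route-AnomalousDissipation-DecimationAxis --off` to reactivate) — unstaffed, not closed; items shared with open routes are served there. `ledger route dormant <id> --off` reactivates.

Route DecimationAxis — realises idea card decimation-axis-designer-fourier-sets: the retained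
Fourier set S ⊂ ℤ³∖{0} is the deformation parameter of the fixed-force zeroth law, and NS^S is the
tree's exact-coupling Fourier–Galerkin field `Literature.Analysis.FluidPDE.galerkinRHS S` (every
surviving triad k = p + q inside S keeps its Navier–Stokes coefficient; S = freqBall K is classical
Galerkin, S = ℤ³ is Navier–Stokes, S = a lattice triad chain is an exact-coefficient shell model, a
sum-free S is linear Stokes).

Thesis X (TRUNCATION-UNIFORM RESOLVED ZEROTH LAW = the ball end of the axis). It suffices to show:
there are a band-limited steady force (a real, transversal, mean-free coefficient family g supported
in freqBall N), budgets E and ε > 0, and viscosities ν_j → 0⁺ such that for every j there exist a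
resolution wavenumber M, a truncation threshold K₀, an equilibration time T₀ and a datum bound R
with: for EVERY truncation K ≥ K₀ some trajectory c of the Galerkin system on S = freqBall K ∖ {0}
at viscosity ν_j (force g restricted to S), started from a datum with Σ(1+|k|²)‖c(0)_k‖² ≤ R, has
running time-averages T⁻¹∫₀ᵀ of the energy Σ_k‖c_k‖² at most E and of the RESOLVED dissipation
ν_j·4π²·Σ_{|k|≤M}|k|²‖c_k‖² at least ε, for all T ≥ T₀. Two uniformities carry all the content: in
the truncation K (what distinguishes this from "DNS shows a plateau") and in the averaging time T;
the resolution wavenumber M = M(j) independent of K is what lets dissipation — only lower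
semicontinuous under weak limits — survive the passage K → ∞ as a finite sum of modes.

Lean: `Target` := ∃ (N : ℕ) (g : (Fin 3 → ℤ) → EuclideanSpace ℂ (Fin 3)), Torus.IsConjSymm g ∧ (∀ k
∉ Torus.freqBall N, g k = 0) ∧ g 0 = 0 ∧ (∀ k, ∑ i, (k i : ℂ) * g k i = 0) ∧ ∃ E ε, 0 < ε ∧ ∃ ν : ℕ
→ ℝ, (∀ j, 0 < ν j) ∧ Tendsto ν atTop (𝓝 0) ∧ ∀ j, ∃ (M K₀ : ℕ) (T₀ R : ℝ), ∀ K ≥ K₀, ∀ S, S =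
(Torus.freqBall K).erase 0 → ∃ c : ℝ → ↥S → ℂ³, (∀ t, c t ∈ galerkinSubspace S) ∧ ContinuousOn c
(Ici 0) ∧ (∀ T, ∀ t ∈ Icc 0 T, HasDerivWithinAt c (galerkinRHS S (ν j) (fun k => g k) (c t)) (Icc 0
T) t) ∧ Σ_k (1+freqNormSq k)‖c 0 k‖² ≤ R ∧ ∀ T ≥ T₀, timeMean (Σ_k ‖c · k‖²) T ≤ E ∧ ε ≤ timeMean (ν
j * (4π² Σ_{freqNormSq k ≤ M²} freqNormSq k * ‖c · k‖²)) T   — all constants exist (lean search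
--decl: galerkinSubspace, galerkinRHS [NSGalerkinFourier], freqBall, freqNormSq, IsConjSymm
[TorusTrigPoly/TorusSobolevNorm], timeMean, longTimeAvgSup, longTimeAvgInf [TurbWave0]); the route
decls elaborate rc 0 (planner Sketch.lean, 2026-08-15).

## Assembly
Deciding theorem (rev ≥ 4, certified natively): closes : GalerkinFloor → UniformEquilibration →
TargetGlue → GalerkinPassage → AnomalousDissipation := fun h₁ h₂ h₃ h₄ => h₄ (h₃ h₁ h₂) — the cruxes
reach the Target through the support item TargetGlue (GalerkinFloor → UniformEquilibration → Target,
bookkeeping with E ↦ 2E) and the Target reaches the summit through the support item GalerkinPassage;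
the legacy item Assembly := GalerkinFloor → UniformEquilibration → AnomalousDissipation is their
composite and stays as an optional corollary. Proof map: GalerkinFloor gives, per j, (M, K₀) and for
each K ≥ K₀ a trajectory with limsup-mean energy ≤ E and liminf-mean resolved dissipation ≥ 2ε;
UniformEquilibration (at ν_j, g, E, ε, M) turns these into (T₀, R)-uniform trajectories with budgets
(2E, ε), i.e. Target with E replaced by 2E; the support item GalerkinPassage (Target →
AnomalousDissipation) is Hopf's construction along the truncations K → ∞ at fixed j: data converge
strongly in L² (uniform H¹ bound), the limit is a global Leray–Hopf solution (tree:
hopf_galerkin_limit_holds and the coefficientwise-at-every-time limit of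
NSHopfWeakConvergence/NSHopfLimit), the resolved dissipation is a finite sum of squared Fourier
modes and converges at every time (dominated convergence in t), the energy mean passes by Fatou, and
meanDissipation ≥ resolved mean ≥ ε, meanEnergy ≤ 2E for the limit because the bounds hold for every
T ≥ T₀.

Rationale: WHY THIS LINE. The card's decimation axis makes the retained mode set S the deformation parameter;
its only honest arrow to the summit is the ball end, and this route files that arrow in a form that
(i) IMPLIES the summit by proved cone facts instead of restating it on modified dynamics (the flaw
that retired galerkin-resolution-ladder-taylor-floor: a fixed truncation K(ν) neither implies nor
follows ZerothLaw), and (ii) repairs the card's own bridge, which routed through Foias–Prodi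
measures where ν∫‖∇u‖²dμ is only lower semicontinuous as K → ∞ (FoiasManleyRosaTemam2001 Ch. IV
(1.33): stationary statistical solutions only satisfy dissipation ≤ injection) — the fix is to
demand the dissipation floor below a K-independent wavenumber M(ν) (K41: M ~ 10 k_η, k_η =
(ε/ν³)^{1/4}; necessarily M ≥ (ε/(4π²νE))^{1/2}, the Taylor wavenumber, by ResolutionFloor), a
finite-dimensional observable that passes to Hopf's Leray–Hopf limit mode by mode (tree:
hopf_galerkin_scheme_exists_holds, hopf_galerkin_limit_holds, coefficientwise limits in
NSHopfLimit/NSHopfWeakConvergence; the same Fatou-on-finite-frequency-sets move is already used in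
Barriers/GravestModeLaminarAttractorGalerkin). Every DNS plateau ever reported (KanedaEtAl2003:
εL/u′³ levelling off at ≈ 0.4–0.5 for Re_λ up to ≈ 1200, k_max η ≈ 1, resolutions up to 4096³) is
literally an instance (j, K) of crux GalerkinFloor; the route turns "the plateau is
resolution-independent once k_max ≳ k_η" into the K-uniformity clause and "a few eddy turnovers
suffice at any resolution" into crux UniformEquilibration, the Galerkin-level, finite-dimensional
form of Ensemble's realisation crux 0215 (the hyperfinite-hull card's diagnosis: realisation = a
standard RATE in the ergodic theorem). Imported areas: finite-dimensional ODE/ergodic theory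
(maximal inequality, absorbing balls, Krylov–Bogoliubov at fixed K) and spectral Galerkin numerics
as evidence (each instance is a polynomial ODE open to validated long-time integration at small K).
The decimation axis proper survives in the support facts SumFreeLaminar/ResolutionFloor (the two
trivial ends) and in the DNS fact that random thinning to ρ ≲ 0.5 of the modes kills the plateau
(arXiv:2603.19180 p.3), the standing warning that K-uniformity is a statement about FULL balls. The
sparse-end calibration crux ChainZerothLaw filed at open (exact-coefficient Narayana triad chain
κ_{n+3} = κ_{n+2} + κ_n, meant as the honest-coupling analogue of the Cheskidov–Friedlander dyadic
theorem, CheskidovFriedlander2009) was DROPPED at rev 5 (route-repair planner, 2026-08-16): two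
independent refuter reviews and the grounder showed that its only triads (κ_n, κ_{n+2}, κ_{n+3})
flatten exponentially — every κ_n aligns with the Perron direction of x³ = x² + 1 (ρ ≈ 1.4656),
sin∠(κ_n, κ_{n+2}) ~ ρ^{−3n/2} — so the exact Navier–Stokes couplings DECAY like ρ^{−n/2} ≈ 0.826ⁿ
along the chain while the viscous rates 4π²ν|κ_n|² grow like ρ^{2n}: NS^{S_L} is a well-coupled
finite core plus nearly linear damped satellites, not a cascade model, and a dissipation floor at
bounded energy as ν → 0 is implausible (evidence SUSPECT_FALSE_1584.md on
stmt-AnomalousDissipation-1584; log-lattice frame arXiv:2005.14027 Thm 1, §6.1). Off-assembly by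
design and suspect-false, the rung only re-entered refuter queues; a ¬-theorem is not cheap
(no-cascade bound for an infinite ODE family as ν → 0, cubic-moment gap) and would have taught
nothing about the thesis. Any future sparse-end rung must use a designer set whose triads keep a
FIXED SHAPE under scaling — the octave lattice S_L = ⋃_{n<L} 2ⁿB of the reduced-wave-vector-set
approximation (EggersGrossmann1991; right-isosceles lattice triads (e₁+e₂) + (e₁−e₂) = 2e₁ couple
octave n to n+1 with ν-independent geometry) — and belongs to a card or route whose thesis it
serves, not to this assembly.
RANKED CRUXES. #2 GalerkinFloor — band-limited steady g, E, ε, ν_j → 0: ∀ j ∃ M K₀ ∀ K ≥ K₀ some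
Galerkin trajectory on freqBall K∖{0} has limsup-mean energy ≤ E and liminf-mean resolved
dissipation (modes |k| ≤ M) ≥ 2ε (why it might fail: the zeroth law itself may fail for every steady
f — laminar/condensate branches, Marchioro rigidity proved at every truncation in tree; or hold only
with truncation-dependent dissipation — bottleneck/partial thermalisation at k ~ K, FrischEtAl2008,
CichowlasEtAl2005 — so that no K-independent M works; sources KanedaEtAl2003, Frisch1995 §5.2,
FoiasManleyRosaTemam2001 Ch. V). #3 UniformEquilibration — ∀ ν N g E ε M ∃ T₀ R ∀ K: if some
trajectory on freqBall K∖{0} has those long-time floors (E, 2ε) then one started in the H¹-ball R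
has running averages ≤ 2E and ≥ ε for all T ≥ T₀ (why it might fail: per K it is trivial — shift the
given trajectory — so the content is K-uniformity of transients; slow near-heteroclinic cycling or
truncation-scale relaxation times could make T₀(K) → ∞, cf. cards cycling-loophole-rate-vs-level,
hyperfinite-hull N3; sources FoiasManleyRosaTemam2001 Ch. IV, DoeringFoias2002 §2). (#4
ChainZerothLaw, the off-assembly Narayana-chain calibration rung filed at open, was dropped at rev 5
— degenerate triads, see WHY THIS LINE; the cruxes are now exactly the two on the deciding path
GalerkinFloor → UniformEquilibration → TargetGlue → GalerkinPassage → summit.)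
KILL CRITERIA. ¬GalerkinFloor proved for ALL band-limited g (a truncation-uniform no-plateau
theorem) closes the route and, via GalerkinPassage read contrapositively, says every zeroth-law
witness dissipates at truncation-dependent or unresolved wavenumbers — a structural fact worth
having. ¬UniformEquilibration (a family of truncations with provably divergent equilibration times
under the floor premise) forces the pivot to the measure form: GalerkinFloor →
EnsembleZerothLawSomeForce (Ensemble 0214, by Krylov–Bogoliubov at fixed K + FMRT limit; resolved
dissipation again passes) and realisation is handed to Ensemble 0215.
NOT DECOMPOSED YET. No split of GalerkinFloor (natural children later: existence of K-uniform
absorbing H¹-time-average bounds — provable; a flux-through-wavenumber-M floor; low-mode injection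
persistence = Correlation's CorrelationPersistence at Galerkin level). Not filed: the card's D3
Rayleigh-monotonicity question D*(S) ≤ D*(S′) for nested sets (conjectured FALSE in general by the
card itself — dodger-hosting modes), its D5 sparse-random-set no-anomaly rung (needs a random-subset
formalism; informal until a grounder types it), a sparse-end calibration rung on a fixed-shape
octave lattice ⋃_{n<L} 2ⁿB (REWA set, EggersGrossmann1991 — the healthy replacement for the dropped
Narayana chain, off-assembly all the same and therefore to be carded separately rather than filed
here) and its helical single-polarisation decimation (needs the helical basis h_±(k), absent from
the tree), and any kit sweep (plancard mode has no compute budget; first tenure action: ODE sweeps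
of octave lattices ⋃_{n<L} 2ⁿB, L ≤ 12, and Bernoulli(ρ) decimations of freqBall 24 at ν down to
10⁻³, recording resolved-dissipation plateaus, as evidence on #2).
CHEAPEST FALSIFIER. For #2/#3: take g = a single first-shell Stokes eigen-force whose planar
Galerkin dynamics is Marchioro-rigid (tree: GravestModeLaminarAttractorGalerkin proves
enstrophy-excess decay at every truncation in 2-D) and check whether the 3-D statement as typed lets
a refuter confine witnesses to a planar invariant sublattice — it does not (∃ g, ∃ trajectory), so
the cheapest real test is numerical: Kolmogorov/Taylor–Green-type band-limited g, pseudo-spectral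
Galerkin runs at K = 32, 48, 64, 96 with ν fixed so that k_η ≈ 20, M = 30: the running means of
resolved dissipation must agree across K to within statistical error after the same T₀; a systematic
K-drift of the plateau at fixed (ν, M) falsifies the K-uniformity clause at accessible cost.
TWO-LAYER PLAN. Foreseen glue only after a crux closes: GalerkinFloor ⇐ (K-uniform time-averaged
enstrophy-flux identity at wavenumber M) ∧ (injection persistence Σ_{|k|≤N} Re⟨g_k, c_k⟩ ≥ 2ε on
average) — the Galerkin energy balance makes flux = injection − resolved dissipation exactly;
UniformEquilibration ⇐ (K-uniform absorbing-ball entrance time, provable) ∧ (K-uniform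
maximal-inequality selection inside the absorbing ball).
SUPPORT. TargetGlue (GalerkinFloor → UniformEquilibration → Target, added rev 4: pure bookkeeping
with budget E ↦ 2E, kernel-checked privately by two planners and two refuters; with GalerkinPassage
it carries the deciding theorem closes := fun h₁ h₂ h₃ h₄ => h₄ (h₃ h₁ h₂)), GalerkinPassage (Target
→ AnomalousDissipation; provable now from the tree's Hopf–Galerkin limit, generalised from data P_K
u₀ to strongly L²-convergent Galerkin data — `initial_inner` is the only clause of
IsHopfGalerkinScheme to relax), ResolutionFloor (one-line Taylor bound), SumFreeLaminar (no internal
triad ⇒ galerkinRHS is the Stokes field; empty double sum in convectionCoeff).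
SOURCES. KanedaEtAl2003; Frisch1995 §5.2; FoiasManleyRosaTemam2001 Ch. IV–V; DoeringFoias2002 §2;
RobinsonRodrigoSadowski2016 Thm 4.4; CheskidovFriedlander2009; Waleffe1992; EggersGrossmann1991;
BiferaleMusacchioToschi2012; FrischEtAl2008; CichowlasEtAl2005; arXiv:2603.19180; arXiv:2005.14027
(log-lattice classification, frame for the dropped chain rung); hub: Ensemble 0214/0215,
CoherentStates 0219, cards hyperfinite-hull-one-loeb-measure,
averaged-ns-nonlinearity-robust-barrier, sabra-rung-monotonicity-test,
galerkin-resolution-ladder-taylor-floor (retired; superseded here by K-uniformity + passage).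

Novelty: Searched 2026-08-15 (this planner, on top of the card's own search log and its refuter audit): `lit
search --hybrid "time averages of Galerkin approximations converge stationary statistical solution
dissipation"` → book:foias2001-navier-stokes-equations-turbulence (FoiasManleyRosaTemam2001) pp.
249–251 (Galerkin solution groups S_m(t) used to prove invariance ⇔ stationarity in 2-D) and Ch. IV
(1.33)–(1.34) p. 198 (stationary statistical solutions: ONLY ν∫‖u‖²dμ ≤ ∫(f,u)dμ — the
semicontinuity gap this route's resolved-dissipation clause is built to close); `lit frontier
AnomalousDissipation --since 2020` (30 descendants, none on Galerkin-uniform statements;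
arXiv:2603.19125 = JFM 2026 is about the multifractal model vs NS, not truncations); `lit search
--source crossref "Cheskidov Friedlander vanishing viscosity dyadic"` → CheskidovFriedlander2009
(doi:10.1016/j.physd.2009.01.011; fixed points of the viscous dyadic chain converge to the anomalous
inviscid fixed point — the model for the chain rung ChainZerothLaw filed at open and dropped at rev
5) and doi:10.1007/s00021-023-00799-3 (survey); `lit read arxiv:2603.19180` p. 3 (held; decimation
to ρ ≲ 0.5 destroys the plateau — the datum behind the card); tree search: `lean search
galerkinRHS|hopf_galerkin_limit|IsHopfGalerkinScheme` (the exact-coupling Galerkin field on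
ARBITRARY finite symmetric S, stationary Galerkin states, and both halves of Hopf's theorem are
PROVED in Literature/Analysis/FluidPDE — nothing states a K-unif  [refs: 10.1016/j.physd.2009.01.011, 10.1007/s00021-023-00799-3, 10.1103/PhysRevE.53.3541, 2603.19125, 2603.19180, book:foias2001-navier-stokes-equations-turbulence, doi:10.1016/j.physd.2009.01.011, doi:10.1007/s00021-023-00799-3, arxiv:2603.19180, doi:10.1103/PhysRevE.53.3541, FoiasManleyRosaTemam2001, CheskidovFriedlander2009, Waleffe1992, FrischEtAl2008, BiferaleMusacchioToschi2012, EggersGrossmann1991]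

Barriers (technique_class: fourier-galerkin truncation-uniformity long-time-averages): - technique_class: fourier-galerkin truncation-uniformity mode-set-deformation
finite-dimensional-ode long-time-averages resolved-dissipation
- Literature.Barriers.AnomalousDissipation.Cheskidov2023_thm13_not_forceRobustNoAnomaly: met only on
the kill side — a refutation of GalerkinFloor for all g by an energy method whose conclusion is
stable under ν-dependent time-periodic O(1)-in-C(ℝ;L²) force perturbations would, through
GalerkinPassage's contrapositive reading, be a force-robust no-anomaly argument of the blocked
class; refuters of #2 must use the steadiness/ν-independence of g or the finite dimensionality
(exact Galerkin energy balance, Liouville) — scope caveat (a) of the barrier. The positive items are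
witness statements and are not in the class.
- Literature.Barriers.AnomalousDissipation.Marchioro1986_globalAttraction: inherited as a constraint
on g and on the witness trajectories — the tree's GravestModeLaminarAttractorGalerkin proves the
laminar enstrophy-excess decay AT EVERY TRUNCATION for first-mode 2-D forcing, so a planar g on the
gravest shell with witnesses inside the planar invariant sublattice has GalerkinFloor false
uniformly in K; evaded by design: g genuinely three-dimensional (transversal family on freqBall N, N
≥ 2 allowed) and trajectories free to leave planar sublattices; the statement is ∃ g.
- Literature.Barriers.AnomalousDissipation.AlexakisDoering2006_energyDissipationBound: same
inheritance — the d = 2 reading (S inside a coordinate plane) has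

History (route lifecycle, newest last):
- 2026-08-16T03:17:56Z · rev 5: dropped ChainZerothLaw — route-repair (rbadge seat, badge/A11): target-unreachable was already repaired at rev 4 by the rchoice seat (TargetGlue = GalerkinFloor → UniformEquilibration → (planner-rbadge-AnomalousDissipation-Decimation-3c808f9a-0)
- 2026-08-25T08:51:21Z · DORMANT — reconciler: no traction for 7.6 d (last activity item-evidence-added at 2026-08-17T19:06:55Z); parked, not closed — `ledger route dormant route-AnomalousDissipa (operator:999:2603250)

sub-problem: AnomalousDissipation · status: dormant · opened planner-plancard-AnomalousDissipation-Anomalo-e8fcbfbb-0 2026-08-15T10:57:27Z · rev 6 · ledger route-AnomalousDissipation-DecimationAxis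
GENERATED by the gate from the ledger (D-0016/17). Provers cite these decls: `theorem foo : Summit.AnomalousDissipation.AnomalousDissipation.Theses.DecimationAxis.<Decl> := …` in Summits/AnomalousDissipation/AnomalousDissipation/Theorems/<Name>.lean.
-/

namespace Summit.AnomalousDissipation.AnomalousDissipation.Theses.DecimationAxis

open scoped BigOperators Topology Manifold Classical MeasureTheory ProbabilityTheory Matrix InnerProductSpace ComplexConjugate ContinuousMap
open Filter Set Function TopologicalSpace MeasureTheory

attribute [summit_statement] _root_.AnomalousDissipation

open Literature.Turb

/-- item stmt-AnomalousDissipation-1580 · target · rank 0 · open · by planner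
why it might fail: At least as strong as ZerothLaw for band-limited steady f, plus K-uniformity and a K-independent resolved wavenumber M(ν): fails if no steady f has a plateau at all (laminar/condensate branches), or if witnesses dissipate at truncation-dependent scales (bottleneck/partial thermalisation near k~K).
sources: KanedaEtAl2003, Sreenivasan1998, FrischEtAl2008, CichowlasEtAl2005, FoiasManleyRosaTemam2001 Ch. IV-V, Frisch1995 §5.2
[target] Thesis X, the ball end of the decimation axis: a band-limited steady force g (real =
IsConjSymm, transversal, g 0 = 0, supported in freqBall N), budgets E, ε > 0, ν_j → 0⁺, and for
every j a resolution wavenumber M, truncation threshold K₀, equilibration time T₀ and datum bound R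
such that for EVERY K ≥ K₀ some trajectory of ċ = galerkinRHS S (ν j) g↾S c on S = freqBall K ∖ {0}
(values in galerkinSubspace S, continuous on [0,∞), one-sided derivatives on every [0,T] — the
solution notion of the tree's exists_galerkin_solution), with Σ(1+|k|²)‖c(0)_k‖² ≤ R, has timeMean
energy Σ‖c_k‖² ≤ E and timeMean resolved dissipation ν_j·4π²·Σ_{|k|≤M}|k|²‖c_k‖² ≥ ε for all T ≥ T₀
(so necessarily T₀ > 0). Normalisations: ∫‖u‖² = Σ_{k∈S}‖c_k‖² and ‖∇u‖² = 4π²Σ|k|²‖c_k‖² for u =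
realTrigPoly S c̄ (TorusTrigPoly: integral_norm_sq_realTrigPoly, toReal_eGradNormSq_realTrigPoly).
Follows from GalerkinFloor ∧ UniformEquilibration with E ↦ 2E; implies the summit by
GalerkinPassage. [difficulty: open-problem] -/
@[route_item "route-AnomalousDissipation-DecimationAxis"]
def Target : Prop :=
  ∃ (N : ℕ) (g : (Fin 3 → ℤ) → EuclideanSpace ℂ (Fin 3)), Literature.Analysis.FunctionSpaces.Torus.IsConjSymm g ∧ (∀ k, k ∉ Literature.Analysis.FunctionSpaces.Torus.freqBall N → g k = 0) ∧ g 0 = 0 ∧ (∀ k : Fin 3 → ℤ, ∑ i, ((k i : ℤ) : ℂ) * g k i = 0) ∧ ∃ (E ε : ℝ), 0 < ε ∧ ∃ ν : ℕ → ℝ, (∀ j, 0 < ν j) ∧ Filter.Tendsto ν Filter.atTop (nhds 0) ∧ ∀ j, ∃ (M K₀ : ℕ) (T₀ R : ℝ), ∀ K, K₀ ≤ K → ∀ S : Finset (Fin 3 → ℤ), S = (Literature.Analysis.FunctionSpaces.Torus.freqBall K).erase 0 → ∃ c : ℝ → ↥S → EuclideanSpace ℂ (Fin 3), (∀ t, c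 t ∈ Literature.Analysis.FluidPDE.galerkinSubspace S) ∧ ContinuousOn c (Set.Ici 0) ∧ (∀ T : ℝ, ∀ t ∈ Set.Icc (0 : ℝ) T, HasDerivWithinAt c (Literature.Analysis.FluidPDE.galerkinRHS S (ν j) (fun k => g k) (c t)) (Set.Icc 0 T) t) ∧ (∑ k : ↥S, (1 + Literature.Analysis.FunctionSpaces.Torus.freqNormSq (k : Fin 3 → ℤ)) * ‖c 0 k‖ ^ 2 ≤ R) ∧ ∀ T : ℝ, T₀ ≤ T → Literature.Analysis.FluidPDE.timeMean (fun t => ∑ k : ↥S, ‖c t k‖ ^ 2) T ≤ E ∧ ε ≤ Literature.Analysis.FluidPDE.timeMean (fun t => ν j * (4 * Real.pi ^ 2 * ∑ k : ↥S, if Literature.Analysis.FunctionSpaces.Torus.freqNormSq (k : Fin 3 → ℤ) ≤ (M : ℝ) ^ 2 then Literature.Analysis.FunctionSpaces.Torus.freqNormSq (k : Fin 3 → ℤ) * ‖c t k‖ ^ 2 else 0)) T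

/-- item stmt-AnomalousDissipation-1582 · crux · rank 2 · open · by planner
why it might fail: ZerothLaw may fail for every steady band-limited g (laminar/condensate branches; Marchioro-type rigidity holds at every truncation, in tree), or hold only with K-dependent dissipation scales (bottleneck/partial thermalisation at k~K: FrischEtAl2008, CichowlasEtAl2005): then no K-independent M, K₀.
sources: KanedaEtAl2003, Sreenivasan1998, Frisch1995 §5.2, FoiasManleyRosaTemam2001 Ch. V, FrischEtAl2008, CichowlasEtAl2005
[crux] GALERKIN FLOOR (the physics; rank 2 = hardest): ∃ band-limited steady g (IsConjSymm,
supported in freqBall N, g 0 = 0, transversal), E, ε > 0, ν_j → 0⁺ such that ∀ j ∃ M K₀ ∀ K ≥ K₀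
SOME trajectory of the exact-coupling Galerkin system galerkinRHS on S = freqBall K ∖ {0} at
viscosity ν j has longTimeAvgSup of the energy Σ‖c_k‖² ≤ E and longTimeAvgInf of the RESOLVED
dissipation ν_j·4π²·Σ_{|k|≤M}|k|²‖c_k‖² ≥ 2ε. This is the theorem-shaped form of the DNS plateau
(KanedaEtAl2003: εL/u′³ ≈ 0.4–0.5, resolution-independent once k_max η ≳ 1): K-uniformity in the
truncation and a K-independent resolution wavenumber M (K41: M ≈ C·k_η, k_η = (ε/ν³)^{1/4};
necessarily M² ≥ ε/(4π²ν_jE) by ResolutionFloor) are the whole content; per (j, K) it is a statement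
about one polynomial ODE with exact energy balance d/dt ½Σ‖c‖² = −ν‖∇u‖² + Σ Re⟨g_k, c_k⟩ (tree:
sum_re_inner_galerkinField_self) and a K-uniform absorbing ball, open to validated long-time
numerics at small K as evidence. Junk notes: Galerkin trajectories are bounded, so the limsup/liminf
of running means are honest (no Real.sSup ∅ branch). Decimation warning (arXiv:2603.19180 p.3):
replacing freqBall K by a random half of it destro -/
@[route_item "route-AnomalousDissipation-DecimationAxis", crux]
def GalerkinFloor : Prop :=
  ∃ (N : ℕ) (g : (Fin 3 → ℤ) → EuclideanSpace ℂ (Fin 3)), Literature.Analysis.FunctionSpaces.Torus.IsConjSymm g ∧ (∀ k, k ∉ Literature.Analysis.FunctionSpaces.Torus.freqBall N → g k = 0) ∧ g 0 = 0 ∧ (∀ k : Fin 3 → ℤ, ∑ i, ((k i : ℤ) : ℂ) * g k i = 0) ∧ ∃ (E ε : ℝ), 0 < ε ∧ ∃ ν : ℕ → ℝ, (∀ j, 0 < ν j) ∧ Filter.Tendsto ν Filter.atTop (nhds 0) ∧ ∀ j, ∃ (M K₀ : ℕ), ∀ K, K₀ ≤ K → ∀ S : Finset (Fin 3 → ℤ),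 S = (Literature.Analysis.FunctionSpaces.Torus.freqBall K).erase 0 → ∃ c : ℝ → ↥S → EuclideanSpace ℂ (Fin 3), (∀ t, c t ∈ Literature.Analysis.FluidPDE.galerkinSubspace S) ∧ ContinuousOn c (Set.Ici 0) ∧ (∀ T : ℝ, ∀ t ∈ Set.Icc (0 : ℝ) T, HasDerivWithinAt c (Literature.Analysis.FluidPDE.galerkinRHS S (ν j) (fun k => g k) (c t)) (Set.Icc 0 T) t) ∧ Literature.Analysis.FluidPDE.longTimeAvgSup (fun t => ∑ k : ↥S, ‖c t k‖ ^ 2) ≤ E ∧ 2 * ε ≤ Literature.Analysis.FluidPDE.longTimeAvgInf (fun t => ν j * (4 * Real.pi ^ 2 * ∑ k : ↥S, if Literature.Analysis.FunctionSpaces.Torus.freqNormSq (k : Fin 3 → ℤ) ≤ (M : ℝ) ^ 2 then Literature.Analysis.FunctionSpaces.Torus.freqNormSq (k : Fin 3 → ℤ) * ‖c t k‖ ^ 2 else 0))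

/-- item stmt-AnomalousDissipation-1583 · crux · rank 3 · open · by planner
why it might fail: Per K trivial (shift the trajectory); all content is K-uniform (T₀,R): heteroclinic-type cycling whose passage times grow as truncation-scale noise shrinks (Holmes et al. 2012 §9.2: T~λ_u⁻¹|log noise|) or slow relaxation at k~K can force T₀(K)→∞; the maximal inequality pins one observable, not two.
sources: FoiasManleyRosaTemam2001 Ch. IV, DoeringFoias2002 §2, doi:10.1017/cbo9780511919701 Ch. 9 §9.2, GuckenheimerHolmes1983, stmt-AnomalousDissipation-0215, AnomalousDissipation/AnomalousDissipation/hyperfinite-hull-one-loeb-measure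
[crux] UNIFORM EQUILIBRATION (the dynamics; rank 3): for every ν > 0, band-limited real transversal
g, budgets E, ε > 0 and resolution M there are T₀ and R such that FOR EVERY truncation K: if some
Galerkin trajectory on freqBall K ∖ {0} has longTimeAvgSup energy ≤ E and longTimeAvgInf resolved
dissipation ≥ 2ε, then some trajectory started from a datum with Σ(1+|k|²)‖c(0)_k‖² ≤ R has running
means timeMean energy ≤ 2E and timeMean resolved dissipation ≥ ε for ALL T ≥ T₀. Per K this is
trivial (shift the given trajectory to a later bounded-enstrophy time — time-averaged enstrophy is
bounded by the Galerkin energy identity — and wait out its own transient), and for K below any K₀ a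
finite maximum works; the content is uniformity of (T₀, R) as K → ∞ at fixed ν: 'a few turnover
times suffice at any resolution'. It is Ensemble's realisation crux stmt-AnomalousDissipation-0215
and the hyperfinite-hull card's N3 (realisation = a standard RATE in the ergodic theorem) moved to
finite dimensions, where invariant measures, Birkhoff, the maximal ergodic inequality (which gives
T₀ = 0 for ONE observable: points with inf_T A_T(diss) ≥ mean − δ have positive measure) and
absorbing balls are hone -/
@[route_item "route-AnomalousDissipation-DecimationAxis", crux]
def UniformEquilibration : Prop :=
  ∀ (ν : ℝ), 0 < ν → ∀ (N : ℕ) (g : (Fin 3 → ℤ) → EuclideanSpace ℂ (Fin 3)), Literature.Analysis.FunctionSpaces.Torus.IsConjSymm g → (∀ k, k ∉ Literature.Analysis.FunctionSpaces.Torus.freqBall N → g k = 0) → g 0 = 0 → (∀ k : Fin 3 → ℤ, ∑ i, ((k i : ℤ) : ℂ) * g k i = 0) → ∀ (E ε : ℝ) (M : ℕ), 0 < ε → ∃ (T₀ R : ℝ), ∀ (K : ℕ) (S : Finset (Fin 3 → ℤ)), S = (Literature.Analysis.FunctionSpaces.Torus.freqBall K).erase 0 → (∃ c : ℝ → ↥S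 → EuclideanSpace ℂ (Fin 3), (∀ t, c t ∈ Literature.Analysis.FluidPDE.galerkinSubspace S) ∧ ContinuousOn c (Set.Ici 0) ∧ (∀ T : ℝ, ∀ t ∈ Set.Icc (0 : ℝ) T, HasDerivWithinAt c (Literature.Analysis.FluidPDE.galerkinRHS S ν (fun k => g k) (c t)) (Set.Icc 0 T) t) ∧ Literature.Analysis.FluidPDE.longTimeAvgSup (fun t => ∑ k : ↥S, ‖c t k‖ ^ 2) ≤ E ∧ 2 * ε ≤ Literature.Analysis.FluidPDE.longTimeAvgInf (fun t => ν * (4 * Real.pi ^ 2 * ∑ k : ↥S, if Literature.Analysis.FunctionSpaces.Torus.freqNormSq (k : Fin 3 → ℤ) ≤ (M : ℝ) ^ 2 then Literature.Analysis.FunctionSpaces.Torus.freqNormSq (k : Fin 3 → ℤ) * ‖c t k‖ ^ 2 else 0))) → ∃ c : ℝ → ↥S → EuclideanSpace ℂ (Fin 3), (∀ t, c t ∈ Literature.Analysis.FluidPDE.galerkinSubspace S) ∧ ContinuousOn c (Set.Ici 0) ∧ (∀ T : ℝ, ∀ t ∈ Set.Icc (0 : ℝ) T, HasDerivWithinAt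 c (Literature.Analysis.FluidPDE.galerkinRHS S ν (fun k => g k) (c t)) (Set.Icc 0 T) t) ∧ (∑ k : ↥S, (1 + Literature.Analysis.FunctionSpaces.Torus.freqNormSq (k : Fin 3 → ℤ)) * ‖c 0 k‖ ^ 2 ≤ R) ∧ ∀ T : ℝ, T₀ ≤ T → Literature.Analysis.FluidPDE.timeMean (fun t => ∑ k : ↥S, ‖c t k‖ ^ 2) T ≤ 2 * E ∧ ε ≤ Literature.Analysis.FluidPDE.timeMean (fun t => ν * (4 * Real.pi ^ 2 * ∑ k : ↥S, if Literature.Analysis.FunctionSpaces.Torus.freqNormSq (k : Fin 3 → ℤ) ≤ (M : ℝ) ^ 2 then Literature.Analysis.FunctionSpaces.Torus.freqNormSq (k : Fin 3 → ℤ) * ‖c t k‖ ^ 2 else 0)) T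

/-- item stmt-AnomalousDissipation-14096 · support · rank 9 · open · by planner
[support] TARGET GLUE (route-choice repair 2026-08-16, needs_repair route.target-unreachable →
option (a) "add glue item Crux… → Target"): GalerkinFloor → UniformEquilibration → Target. Pure
bookkeeping, provable now (≈ 10 lines; elaborated rc 0 and proved privately in the planner's
Sketch.lean): unpack GalerkinFloor's data (N, g, conj-symmetry, support in freqBall N, g 0 = 0,
transversality, E, ε, 0 < ε, ν, positivity, ν → 0); instantiate Target with the SAME N, g, ε, ν and
energy budget 2·E; for each j take (M, K₀) from GalerkinFloor and (T₀, R) from UniformEquilibration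
applied at (ν j, N, g, E, ε, M); for K ≥ K₀ and S = (freqBall K).erase 0 the Floor trajectory is
literally the premise of UniformEquilibration at (K, S), whose conclusion is literally Target's
clause with E ↦ 2·E (same lambda terms after β-reduction: datum Σ(1+|k|²)‖c 0 k‖² ≤ R, timeMean
energy ≤ 2·E, ε ≤ timeMean resolved dissipation at (ν j, M) for all T ≥ T₀). Lean sketch: intro hF
hU; obtain ⟨N,g,hs,hsupp,hg0,htr,E,ε,hε,ν,hν,hlim,hj⟩ := hF; refine
⟨N,g,hs,hsupp,hg0,htr,2*E,ε,hε,ν,hν,hlim,fun j => ?_⟩; obtain ⟨M,K₀,hK⟩ := hj j; obtain ⟨T₀,R,hTR⟩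
:= hU (ν j) (hν j) N g hs hsupp hg0 htr E ε M hε; exact ⟨M,K₀,T₀, -/
@[route_item "route-AnomalousDissipation-DecimationAxis", crux]
def TargetGlue : Prop :=
  GalerkinFloor → UniformEquilibration → Target

/-- item stmt-AnomalousDissipation-1585 · support · rank 9 · open · by planner
[support] GALERKIN PASSAGE: Target → AnomalousDissipation — the glue that makes the route
non-vacuous; provable now from tree facts. Sketch: f := realTrigPoly ((freqBall N).erase 0) g is
smooth, div-free (transversality, isDivFree_realTrigPoly), mean-zero
(hasZeroMean_realTrigPoly_of_zero_not_mem). Fix j; K_n := K₀ + n; Target gives trajectories c_n on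
S_n with data bounded in H¹ by R ⇒ (diagonal argument + tail bound Σ_{|k|>Λ}‖c_n(0)_k‖² ≤ R/Λ²) a
subsequence of data fields converges STRONGLY in L² to some u₀; run the Hopf–Galerkin limit
(NSHopfGalerkinExistence/NSHopfLimit/NSHopfEnergy/NSHopfGalerkinLimit: hopf_galerkin_limit_holds,
IsHopfGalerkinScheme.exists_limitField, coefficientwise convergence at every t ≥ 0 —
NSHopfWeakConvergence) generalised from data P_K u₀ to strongly convergent Galerkin data (the only
clause of IsHopfGalerkinScheme to relax is initial_inner; identification of u(0) and the energy
inequality from 0 use only U_n 0 → u₀ in L²) ⇒ global Leray–Hopf u from u₀. For every T ≥ T₀: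
timeMean (∫‖u‖²) T ≤ E by Fatou (modes, then time), and timeMean of the resolved dissipation of u
equals the limit of the Galerkin ones (finite sum of modes |k| ≤ M, pointwise-in-t co -/
@[route_item "route-AnomalousDissipation-DecimationAxis", crux]
def GalerkinPassage : Prop :=
  Target → AnomalousDissipation

/-- item stmt-AnomalousDissipation-1586 · support · rank 9 · open · by planner
[support] RESOLUTION FLOOR (card fact (R), the Taylor-microscale necessity): on any finite set S
whose wavenumbers satisfy |k|² ≤ Λ, ν·4π²Σ|k|²‖c_k‖² ≤ ν·4π²Λ·Σ‖c_k‖² — so a dissipation floor ε at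
energy ≤ E needs Λ ≥ ε/(4π²νE): the resolved wavenumber M of GalerkinFloor/Target and the chain
length of ChainZerothLaw must reach the Taylor wavenumber (nothing forces the Kolmogorov wavenumber
at this level). One-line Finset.sum_le_sum + mul_le_mul. [difficulty: S, provable now] -/
@[route_item "route-AnomalousDissipation-DecimationAxis"]
def ResolutionFloor : Prop :=
  ∀ (S : Finset (Fin 3 → ℤ)) (Λ ν : ℝ), 0 ≤ ν → (∀ k ∈ S, Literature.Analysis.FunctionSpaces.Torus.freqNormSq k ≤ Λ) → ∀ c : ↥S → EuclideanSpace ℂ (Fin 3), ν * (4 * Real.pi ^ 2 * ∑ k : ↥S, Literature.Analysis.FunctionSpaces.Torus.freqNormSq (k : Fin 3 → ℤ) * ‖c k‖ ^ 2) ≤ ν * (4 * Real.pi ^ 2 * Λ) * ∑ k : ↥S, ‖c k‖ ^ 2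

/-- item stmt-AnomalousDissipation-1587 · support · rank 9 · open · by planner
[support] SUM-FREE SETS ARE LINEAR (card fact (L), the trivial end of the axis): if S contains no
additive triple p + q = k (p, q, k ∈ S), then for every ν, g, c and k ∈ S, galerkinRHS S ν g c k =
−ν4π²|k|² c_k + Π_k g_k, i.e. the convection symbol convectionCoeff S c̄ c̄ k (a double sum over l,
m ∈ S of `if l + m = k then … else 0`, NSGalerkinFourier) is an empty sum: NS^S is the Stokes
system, every trajectory relaxes to c_k = Π_k g_k/(4π²ν|k|²) with energy ~ ν⁻², and no zeroth law
holds on S at bounded energy — the anomaly needs triads. Proof: unfold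
galerkinRHS_apply/galerkinField_def, Finset.sum_eq_zero with the hypothesis, coeffExt_coe, sub_zero.
[difficulty: S, provable now] -/
@[route_item "route-AnomalousDissipation-DecimationAxis"]
def SumFreeLaminar : Prop :=
  ∀ (S : Finset (Fin 3 → ℤ)), (∀ k ∈ S, ∀ p ∈ S, ∀ q ∈ S, p + q ≠ k) → ∀ (ν : ℝ) (g c : ↥S → EuclideanSpace ℂ (Fin 3)) (k : ↥S), Literature.Analysis.FluidPDE.galerkinRHS S ν g c k = -((((ν * (4 * Real.pi ^ 2 * Literature.Analysis.FunctionSpaces.Torus.freqNormSq (k : Fin 3 → ℤ))) : ℝ) : ℂ) • c k) + Literature.Analysis.FluidPDE.Torus.leraySym (k : Fin 3 → ℤ) (g k)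

/-- item stmt-AnomalousDissipation-1581 · assembly · rank 1 · open · by planner
[assembly] GalerkinFloor → UniformEquilibration → AnomalousDissipation. Proof map (≤ 40 lines given
GalerkinPassage): fix the data (N, g, E, ε, ν) of GalerkinFloor; for each j take (M, K₀) from
GalerkinFloor and (T₀, R) from UniformEquilibration applied at (ν j, N, g, E, ε, M); for K ≥ K₀ the
Floor trajectory is the premise of UniformEquilibration at (K, S), whose conclusion is exactly the
Target clause with budgets (2·E, ε); hence Target holds (with E replaced by 2E), and GalerkinPassage
: Target → AnomalousDissipation finishes. All the analysis lives in GalerkinPassage (support item);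
this item is bookkeeping once that lands. [deps: GalerkinPassage] [difficulty: S given
GalerkinPassage, L otherwise] -/
@[route_item "route-AnomalousDissipation-DecimationAxis"]
def Assembly : Prop :=
  GalerkinFloor → UniformEquilibration → AnomalousDissipation

/-! D-0027 §2.1 — DECIDING THEOREM (planner-authored via `route open/edit --closes-file`; by planner-rchoice-AnomalousDissipation-Decimatio-491d3323-0 2026-08-16T03:04:21Z):
its hypotheses are this route's items and its conclusion the sub-problem Statement (glue_lint), and it elaborates with this file. -/

@[closes "route-AnomalousDissipation-DecimationAxis"] theorem closes (h₁ : GalerkinFloor) (h₂ : UniformEquilibration) (h₃ : TargetGlue) (h₄ : GalerkinPassage) :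
    _root_.AnomalousDissipation :=
  h₄ (h₃ h₁ h₂)

end Summit.AnomalousDissipation.AnomalousDissipation.Theses.DecimationAxis
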